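import Literature.Computation.Certificates.GramSOSWindows

/-!
# Monomial-windowed residual with the FREE Gram block windowed in the kernel (no shipped parts)

Companion of `GramSOSWindows.lean` (ladder GRIDFUSION, lane «X3 windowed residual»): there the free
block `σ₀` enters the windowed residual through SHIPPED row-range parts certified by
`GramL.ChunkEqs`; here every row of the free block is windowed in the kernel (`Poly.gramRowsW`: the
row term list is filtered to the window BEFORE it is merged), so that a certificate needs neither
partial-sum literals nor chunk files — for gridfusion #50 that is −1.16 MB of `P_t` literals and −7
files. Cost per window: all `s²` row terms are formed and window-tested (cheap: one monomial product
and one weighted exponent sum mod `n + 1` each), only the in-window ones are merged.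

* `Poly.gramRowsW ws n k srt basis heads rows`, `Poly.sum_eval_gramRowsW` (summed over the windows it
  is `GramL.gramRows`);
* `Poly.residualL1W ws n k p gs hs free Gs ts`, `Poly.sum_eval_residualL1W`;
* **`Poly.nonneg_of_windowsL1`** — soundness: `QuadNonneg` of the free block and of every multiplier
  block (any PSD lane), the shipped block polynomials (`GramL.GramPolyEqs`), one
  `isZero (residualL1W ws n k …)` per window (`Poly.AllWindows`) ⇒ `0 ≤ p.eval x` wherever the
  hypotheses hold. Same conclusion as `Poly.nonneg_of_quadL` / `Poly.nonneg_of_windowsL`.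

References: [cite: BlekhermanParriloThomas2012, Thm 3.39], [cite: BlekhermanParriloThomas2012, Thm 3.127];
window partition [folklore]. No PSD check, no new axioms, `decide +kernel` only in the test.
-/

namespace Literature.Computation.Certificates

namespace SOS

open Poly

namespace Poly

section WindowedRows

variable {R : Type*} [Field R] [CharZero R]

/-- Windowed Gram polynomial of the rows with head monomials `heads` against `basis`: every row's
term list is filtered to window `k` BEFORE it is (optionally merge-sort normalised and) merged —
the in-kernel alternative to shipped row-range parts. [cite: BlekhermanParriloThomas2012, Thm 3.39] -/
def gramRowsW (ws : List ℕ) (n k : ℕ) (srt : Bool) (basis : List Monomial) :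
    List Monomial → List (List ℚ) → Poly
  | ma :: mas, row :: rows =>
    add (if srt then filterW ws n k (GramL.rowTermsL ma row basis)
         else normMS (filterW ws n k (GramL.rowTermsL ma row basis)))
      (gramRowsW ws n k srt basis mas rows)
  | _, _ => []

/-- Summed over the windows, the windowed Gram polynomial is the Gram polynomial `GramL.gramRows`
(refinement lemma of the window split). [cite: MartinDorelRoux2017, §3] -/
theorem sum_eval_gramRowsW (x : ℕ → R) (ws : List ℕ) (n : ℕ) (srt : Bool) (basis : List Monomial) :
    ∀ (heads : List Monomial) (rows : List (List ℚ)),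
      ∑ k ∈ Finset.range (n + 1), eval x (gramRowsW ws n k srt basis heads rows) =
        eval x (GramL.gramRows srt basis heads rows)
  | [], rows => by cases rows <;> simp [gramRowsW, GramL.gramRows]
  | ma :: mas, [] => by simp [gramRowsW, GramL.gramRows]
  | ma :: mas, row :: rows => by
      have ih := sum_eval_gramRowsW x ws n srt basis mas rows
      have hrow : eval x (GramL.rowPolyL srt ma row basis) = eval x (GramL.rowTermsL ma row basis) := by
        unfold GramL.rowPolyL; split_ifs <;> simp
      have hwin : ∀ k, eval x (if srt then filterW ws n k (GramL.rowTermsL ma row basis)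
          else normMS (filterW ws n k (GramL.rowTermsL ma row basis))) =
            eval x (filterW ws n k (GramL.rowTermsL ma row basis)) := by
        intro k; split_ifs <;> simp
      rw [GramL.gramRows, eval_add, hrow, ← ih]
      simp only [gramRowsW, eval_add, hwin, Finset.sum_add_distrib, sum_eval_filterW]

/-- **Windowed residual, free block computed in the kernel** (no shipped parts): the window-`k`
terms of `p − (σ₀ + Σᵢ gᵢ Gᵢ + Σⱼ hⱼ tⱼ)` with `σ₀ = free.poly` windowed row by row.
[cite: BlekhermanParriloThomas2012, Thm 3.127] -/
def residualL1W (ws : List ℕ) (n k : ℕ) (p : Poly) (gs hs : List Poly) (free : GramL)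
    (Gs ts : List Poly) : Poly :=
  add (normMS (filterW ws n k p))
    (neg (add (gramRowsW ws n k (GramL.ascending free.basis) free.basis free.basis free.Q)
      (add (ineqPartLW ws n k gs Gs) (eqPartLW ws n k hs ts))))

/-- Summed over the windows, the in-kernel windowed residuals evaluate to the full residual value
(refinement lemma). [cite: MartinDorelRoux2017, §3] -/
theorem sum_eval_residualL1W (x : ℕ → R) (ws : List ℕ) (n : ℕ) (p : Poly) (gs hs : List Poly)
    (free : GramL) (Gs ts : List Poly) :
    ∑ k ∈ Finset.range (n + 1), eval x (residualL1W ws n k p gs hs free Gs ts) =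
      eval x p - (eval x free.poly + ineqVal x gs Gs + eqVal x hs ts) := by
  simp only [residualL1W, eval_add, eval_neg, eval_normMS, Finset.sum_add_distrib,
    Finset.sum_neg_distrib, sum_eval_filterW, sum_eval_gramRowsW, sum_eval_ineqPartLW,
    sum_eval_eqPartLW, GramL.poly]
  ring

end WindowedRows

/-- Every window in range satisfies the assembled property (local copy of the private helper of
`GramSOSWindows.lean`). [folklore] -/
private theorem AllWindows.forall' {P : ℕ → Prop} : ∀ {k n : ℕ}, AllWindows P k n → ∀ i, i < n → P (k + i)
  | _, 0, _, _, hi => absurd hi (Nat.not_lt_zero _)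
  | k, n + 1, h, i, hi => by
      rcases i with _ | i
      · simpa using h.1
      · have h' := AllWindows.forall' h.2 i (Nat.lt_of_succ_lt_succ hi)
        have e : k + (i + 1) = k + 1 + i := by omega
        rw [e]
        exact h'

section Ordered

variable {R : Type*} [Field R] [LinearOrder R] [IsStrictOrderedRing R]

/-- **Soundness, WINDOWED form with the free block computed in the kernel** (no shipped row-range
parts, no `ChunkEqs`): `QuadNonneg` of the free block and of every multiplier block, the shipped
block polynomials, and one zero test `isZero (residualL1W ws n k …)` per window.
[cite: BlekhermanParriloThomas2012, Thm 3.127] -/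
theorem nonneg_of_windowsL1 {p : Poly} {gs hs : List Poly} {free : GramL} {ineq : List GramL}
    {ts Gs : List Poly} {ws : List ℕ} {n : ℕ}
    (hf : free.toGramSOS.QuadNonneg R) (hσ : ∀ σ ∈ ineq, σ.toGramSOS.QuadNonneg R)
    (hG : GramL.GramPolyEqs ineq Gs)
    (hW : AllWindows (fun k => isZero (residualL1W ws n k p gs hs free Gs ts) = true) 0 (n + 1))
    (x : ℕ → R) (hg : ∀ g ∈ gs, 0 ≤ eval x g) (hh : ∀ h ∈ hs, eval x h = 0) : 0 ≤ eval x p := by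
  have hzero : ∑ k ∈ Finset.range (n + 1), eval x (residualL1W ws n k p gs hs free Gs ts) = 0 := by
    refine Finset.sum_eq_zero fun k hk => ?_
    have hk' := AllWindows.forall' hW k (Finset.mem_range.1 hk)
    simp only [Nat.zero_add] at hk'
    exact eval_eq_zero_of_isZero x hk'
  rw [sum_eval_residualL1W, eqVal_eq_zero x hs ts hh] at hzero
  have h1 := free.eval_poly_nonneg_of_quadNonneg hf x
  have h2 := GramL.ineqVal_nonneg x gs ineq Gs hG hσ hg
  linarith

end Ordered

end Poly

/-! ### Test (kernel-checked) -/

section TestsW1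

open Poly

/-- Test (free block windowed IN THE KERNEL, two windows): the `2a² − 2ab + 2b²` example again,
without shipped parts (`residualL1W` / `nonneg_of_windowsL1`). -/
example (a b : ℝ) : 0 ≤ 2 * a ^ 2 - 2 * a * b + 2 * b ^ 2 := by
  let σ : GramL := ⟨[([1] : List ℕ), ([0, 1] : List ℕ)], [[2, -1], [-1, 2]], [], []⟩
  have hq : σ.toGramSOS.QuadNonneg ℝ :=
    σ.quadNonneg_of_gramCertZ (Arows := [[8, -4], [-4, 8]]) (d := ![2, 1]) (B := !![2, -1; 0, 2])
      (c := 4) (by decide +kernel) (by norm_num) (by decide +kernel)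
  have hW : AllWindows (fun k => isZero (residualL1W [1] 1 k
      [(([0, 2] : List ℕ), (2 : ℚ)), (([1, 1] : List ℕ), (-2 : ℚ)), (([2] : List ℕ), (2 : ℚ))] [] [] σ [] [])
      = true) 0 2 :=
    ⟨by decide +kernel, by decide +kernel, trivial⟩
  have h := nonneg_of_windowsL1 (gs := []) (hs := []) (ineq := []) (ts := []) (Gs := [])
    (p := [(([0, 2] : List ℕ), (2 : ℚ)), (([1, 1] : List ℕ), (-2 : ℚ)), (([2] : List ℕ), (2 : ℚ))])
    hq (by simp) trivial hW (vars [a, b]) (by simp) (by simp)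
  simp only [eval_cons, eval_nil, Monomial.eval_eq, Monomial.evalFrom_cons, Monomial.evalFrom_nil,
    vars_cons_zero, vars_cons_succ] at h
  push_cast at h
  linarith

end TestsW1

end SOS

end Literature.Computation.Certificates
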